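import Summits.CriticalPhenomena.PercolationContinuityZ3.Theorems.PercNearOneGluingNoHeavyQuantReflectionHeavy
import Summits.CriticalPhenomena.PercolationContinuityZ3.Theorems.PercNearOneGluingNoHeavyQuantZeroLowHeavy
import HarnessLib

/-!
# QUANT lane R8, T-DEC: n EQUAL BLOBS WITH A COMMON GATE `g ≥ 1/2` ARE HEAVY AT `(g, n·k·g)` FOR EVERY n — the binomial blob law in closed
# form and its reflection capacity (prim-quant-census-2 gen 81)

builds on p205010 (kernel theorem, internal audit signed; external expert review pending)

Support file (`--supports stmt-CriticalPhenomena-4575`), QUANT lane census seat prim-quant-census-2 (gen 81); memo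
`run/shared/lean/prim/quant/prim-quant-census-2-g81/AFL-G81.md` §2.  Theorems only, standard axioms, no sorries, no definitions.

* **`blobLaw_replicate`** — the law of `n` blobs `(k, g)`: `blobLaw (replicate n (k,g)) (j·k) = C(n,j)·g^j·(1−g)^{n−j}` (`k ≥ 1`, every `j`; zero
  off the multiples of `k` by `blobLaw_eq_zero_of_not_dvd`); `blobTop_replicate = n·k`, `blobMean_replicate = n·k·g`.
* **`reflection_capacity_replicate`** (`1/2 ≤ g ≤ 1`): `g·μ b ≤ (1−g)·μ (n·k − b)` on the low atoms `2b < n·k·g` — i.e.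
  `(1−g)^{n−2j−1} ≤ g^{n−2j−1}`.
* **`heavy_blobLaw_replicate_of_half_le`** — `n` EQUAL BLOBS WITH A COMMON GATE `g ∈ [1/2, 1)` ARE HEAVY AT FLOOR `g` AND TARGET THEIR MEAN `n·k·g`,
  for EVERY `n` and `k` (`heavy_of_reflection`): conjecture BLOB-AFL (`TRIPLE-G80.md` §5) in the case `c = 1`, `g ≥ 1/2`, uniformly in the width
  (with `heavy_blobLaw_of_mean_le_two` the binomial family is covered for `g ≥ 1/2` or `n·g ≤ 2`).  `decAtT_blobLaw_replicate_of_half_le`: every layer.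
Census (guidance, memo §3): the binomial is numerically the EXTREMAL gate vector of BLOB-AFL at fixed `(n, Σg)` (0 / ≈ 4 400 vectors below it; hill-climbs
converge to it); the general-gates reflection capacity (all `gᵢ ≥ 1/2`) holds numerically but its symmetric-function inequality is not attempted here.

HONEST STATUS.  BLOB-AFL for `g < 1/2`, `Σg > 2` is open beyond width 4; `SiblingStep`, `FarTreeRow` OPEN; RATE class (log\*) / honest sentence of
`run/shared/lean/prim/quant/README.md` unchanged.  [this work].  Nothing here is cited as a published result.  The gluing rows served
[cite: KozmaNitzan2024, Conjecture 3 (p. 15)]; product measure [cite: Grimmett1999, §1.3 p. 10].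
-/

noncomputable section

open scoped BigOperators

namespace Summit.CriticalPhenomena.PercolationContinuityZ3.Theorems
namespace Quant

open Finset

/-- the two-point law `{lo, hi; g}` (as in `…QuantLawDEC`) -/
local notation3 "TP[" lo ", " hi ", " g ", " h "]" =>
  (g : ℝ) * (if (h : ℕ) = (hi : ℕ) then (1 : ℝ) else 0) + (1 - (g : ℝ)) * (if (h : ℕ) = (lo : ℕ) then (1 : ℝ) else 0)

namespace LawDec

/-! ### The binomial blob law `blobLaw (replicate n (k, g))` -/

/-- top of `n` blobs `(k, g)`. [this work] -/
theorem blobTop_replicate (n k : ℕ) (g : ℝ) : blobTop (List.replicate n (k, g)) = n * k := by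
  induction n with
  | zero => simp [blobTop]
  | succ n ih => rw [List.replicate_succ]; simp only [blobTop]; rw [ih]; ring

/-- mean of `n` blobs `(k, g)`. [this work] -/
theorem blobMean_replicate (n k : ℕ) (g : ℝ) : blobMean (List.replicate n (k, g)) = n * k * g := by
  induction n with
  | zero => simp [blobMean]
  | succ n ih => rw [List.replicate_succ]; simp only [blobMean]; rw [ih]; push_cast; ring

/-- **the binomial blob law**: for `k ≥ 1`, `blobLaw (replicate n (k,g)) (j·k) = C(n,j)·g^j·(1−g)^{n−j}` for every `j` (both sides vanish
for `j > n`). [this work] -/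
theorem blobLaw_replicate (k : ℕ) (hk : 0 < k) (g : ℝ) :
    ∀ n j : ℕ, blobLaw (List.replicate n (k, g)) (j * k) = (n.choose j : ℝ) * g ^ j * (1 - g) ^ (n - j)
  | 0, j => by
    simp only [List.replicate_zero, blobLaw]
    rcases Nat.eq_zero_or_pos j with hj | hj
    · subst hj; simp
    · rw [if_neg (Nat.mul_pos hj hk).ne', Nat.choose_eq_zero_of_lt hj]; simp
  | n + 1, 0 => by
    have h0 := blobLaw_replicate k hk g n 0
    rw [Nat.zero_mul] at h0
    rw [List.replicate_succ]
    simp only [blobLaw, slice, Nat.zero_mul]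
    rw [if_neg (show ¬ k ≤ 0 by omega), mul_zero, add_zero, h0, Nat.choose_zero_right, Nat.choose_zero_right, pow_zero,
      Nat.sub_zero, Nat.sub_zero, pow_succ]
    push_cast
    ring
  | n + 1, j + 1 => by
    rw [List.replicate_succ]
    simp only [blobLaw, slice]
    rw [if_pos (by nlinarith : k ≤ (j + 1) * k), show (j + 1) * k - k = j * k by rw [Nat.add_mul, one_mul, Nat.add_sub_cancel],
      blobLaw_replicate k hk g n (j + 1), blobLaw_replicate k hk g n j, Nat.choose_succ_succ, Nat.cast_add,
      show n + 1 - (j + 1) = n - j by omega]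
    rcases le_or_gt (j + 1) n with hjn | hjn
    · rw [show n - j = (n - (j + 1)) + 1 by omega]
      ring
    · rw [Nat.choose_eq_zero_of_lt hjn, show n - (j + 1) = 0 by omega]
      rcases Nat.lt_succ_iff.1 hjn |>.eq_or_lt with hj | hj
      · subst hj; simp; ring
      · rw [Nat.choose_eq_zero_of_lt hj, show n - j = 0 by omega]; simp

/-! ### n equal blobs with a common gate `g ≥ 1/2` are heavy at `(g, n·k·g)`, every `n` -/

/-- **REFLECTION CAPACITY OF THE BINOMIAL BLOB LAW** (`g ≥ 1/2`): for a low atom `b` (`2b < n·k·g`),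
`g·μ b ≤ (1−g)·μ (n·k − b)`, `μ = blobLaw (replicate n (k,g))`. [this work] -/
theorem reflection_capacity_replicate (n k : ℕ) {g : ℝ} (hg : 1 / 2 ≤ g) (hg1 : g ≤ 1) (b : ℕ)
    (hb : 2 * (b : ℝ) < (n : ℝ) * k * g) :
    g * blobLaw (List.replicate n (k, g)) b ≤ (1 - g) * blobLaw (List.replicate n (k, g)) (n * k - b) := by
  have hg0 : 0 ≤ g := by linarith
  have h1g : 0 ≤ 1 - g := by linarith
  have hgates : ∀ p ∈ List.replicate n (k, g), 0 ≤ p.2 ∧ p.2 ≤ 1 := fun p hp => by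
    rw [List.eq_of_mem_replicate hp]; exact ⟨hg0, hg1⟩
  rcases Nat.eq_zero_or_pos k with hk | hk
  · subst hk
    simp only [Nat.cast_zero, mul_zero, zero_mul] at hb
    linarith [(by positivity : (0 : ℝ) ≤ 2 * (b : ℝ))]
  by_cases hdvd : k ∣ b
  · obtain ⟨j, rfl⟩ := hdvd
    have hk0 : (0 : ℝ) < k := by exact_mod_cast hk
    -- `2j < n g ≤ n`, so `2j + 1 ≤ n`
    have h2j : 2 * (j : ℝ) < n * g := by
      have : 2 * ((k * j : ℕ) : ℝ) = (2 * (j : ℝ)) * k := by push_cast; ring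
      rw [this] at hb
      have hb' : (2 * (j : ℝ)) * k < ((n : ℝ) * g) * k := by linarith
      exact lt_of_mul_lt_mul_right hb' hk0.le
    have hjn : 2 * j + 1 ≤ n := by
      have : (2 * j : ℝ) < n := by nlinarith [(Nat.cast_nonneg n : (0 : ℝ) ≤ n)]
      exact_mod_cast this
    rw [show k * j = j * k by ring, show n * k - j * k = (n - j) * k by rw [Nat.sub_mul],
      blobLaw_replicate k hk g n j, blobLaw_replicate k hk g n (n - j), Nat.choose_symm (by omega : j ≤ n),
      show n - (n - j) = j by omega]
    -- `g^{j+1}(1-g)^{n-j} ≤ g^{n-j}(1-g)^{j+1}`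
    have hm : n - j = (j + 1) + (n - 2 * j - 1) := by omega
    rw [hm, pow_add (1 - g) (j + 1) (n - 2 * j - 1), pow_add g (j + 1) (n - 2 * j - 1)]
    have hpow : (1 - g) ^ (n - 2 * j - 1) ≤ g ^ (n - 2 * j - 1) := pow_le_pow_left₀ h1g (by linarith) _
    have hC : (0 : ℝ) ≤ (n.choose j : ℝ) * (g ^ j * (1 - g) ^ j) * (g * (1 - g)) := by positivity
    calc g * ((n.choose j : ℝ) * g ^ j * ((1 - g) ^ (j + 1) * (1 - g) ^ (n - 2 * j - 1)))
        = (n.choose j : ℝ) * (g ^ j * (1 - g) ^ j) * (g * (1 - g)) * (1 - g) ^ (n - 2 * j - 1) := by ring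
      _ ≤ (n.choose j : ℝ) * (g ^ j * (1 - g) ^ j) * (g * (1 - g)) * g ^ (n - 2 * j - 1) :=
          mul_le_mul_of_nonneg_left hpow hC
      _ = (1 - g) * ((n.choose j : ℝ) * (g ^ (j + 1) * g ^ (n - 2 * j - 1)) * (1 - g) ^ j) := by ring
  · rw [blobLaw_eq_zero_of_not_dvd k (List.replicate n (k, g)) (fun p hp => by rw [List.eq_of_mem_replicate hp]) b hdvd,
      mul_zero]
    exact mul_nonneg h1g (blobLaw_nonneg _ hgates _)

/-- **n EQUAL BLOBS WITH A COMMON GATE `g ∈ [1/2, 1)` ARE HEAVY AT FLOOR `g`, TARGET `n·k·g` — EVERY `n`, EVERY `k`** (conjecture BLOB-AFL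
of `TRIPLE-G80.md` §5, case `c = 1`, `g ≥ 1/2`, uniformly in the width): the reflection certificate `b ↔ n·k − b` at the floor gate
(`heavy_of_reflection` + `reflection_capacity_replicate`). [this work] -/
theorem heavy_blobLaw_replicate_of_half_le (n k : ℕ) {g : ℝ} (hg : 1 / 2 ≤ g) (hg1 : g < 1) :
    ∃ (ι : Type) (_ : Fintype ι) (lam γ : ι → ℝ) (lo hi : ι → ℕ),
      (∀ i, 0 ≤ lam i) ∧ (∑ i, lam i = 1) ∧ (∀ i, 0 ≤ γ i ∧ γ i ≤ 1) ∧ (∀ i, lo i ≤ hi i) ∧ (∀ i, hi i ≤ n * k) ∧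
      (∀ h, blobLaw (List.replicate n (k, g)) h = ∑ i, lam i * TP[lo i, hi i, γ i, h]) ∧
      (∀ i, 0 < lam i → g ≤ γ i ∧ (n : ℝ) * k * g ≤ 2 * (lo i : ℝ) + ((hi i : ℝ) - lo i) * γ i) := by
  have hg0 : 0 ≤ g := by linarith
  have hgates : ∀ p ∈ List.replicate n (k, g), 0 ≤ p.2 ∧ p.2 ≤ 1 := fun p hp => by
    rw [List.eq_of_mem_replicate hp]; exact ⟨hg0, hg1.le⟩
  have htop := blobTop_replicate n k g
  refine heavy_of_reflection (n * k) (blobLaw (List.replicate n (k, g))) g ((n : ℝ) * k * g) hg0 hg1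
    (blobLaw_nonneg _ hgates) (fun h hh => blobLaw_eq_zero _ h (by rw [htop]; exact hh)) ?_ ?_
    (fun b hb => reflection_capacity_replicate n k hg hg1.le b hb)
  · have h1 := sum_blobLaw (List.replicate n (k, g)); rwa [htop] at h1
  · push_cast; nlinarith [mul_nonneg (Nat.cast_nonneg n : (0 : ℝ) ≤ n) (Nat.cast_nonneg k : (0 : ℝ) ≤ k)]

/-- **hence DEC at every layer** for `n` equal blobs with a common gate `g ≥ 1/2`. [this work] -/
theorem decAtT_blobLaw_replicate_of_half_le (n k : ℕ) {g : ℝ} (hg : 1 / 2 ≤ g) (hg1 : g < 1) (j : ℕ) :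
    DECAtT g ((n : ℝ) * k * g) j (n * k) (blobLaw (List.replicate n (k, g))) :=
  decAtT_of_heavy _ _ _ _ (heavy_blobLaw_replicate_of_half_le n k hg hg1) j

end LawDec
end Quant
end Summit.CriticalPhenomena.PercolationContinuityZ3.Theorems
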